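import Summits.CriticalPhenomena.PercolationContinuityZ3.Theorems.PercShatteringRaceNearLinearTwoClusterDecayOfSparseShellNonCertainty
import Literature.Probability.Percolation.ClusterExplorationDecoupling

/-!
# `NearLinearTwoClusterDecay` (stmt-CriticalPhenomena-5785) REDUCED to "two independent critical crossings
# meet" (line `first-cluster-exploration-independent-crossings-meet`, certified composition)

Route `PercShatteringRace`, crux `U(1/6)` = `NearLinearTwoClusterDecay`. This file lands the composition of the
lead skeleton (`Cruxes/NearLinearTwoClusterDecay/Lines/first_cluster_exploration_independent_crossings_meet.lean`,
rev L1) as honest theorems. Vocabulary (landed, `…OfShellNonCertainty.lean`): the open shell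
`T(N,R) = Λ(R) ∖ Λ(N)`, its inner layer `Λ(N+1) ∖ Λ(N)`, `Sh(N,R)` = "the configuration restricted to `T` has two
`T`-distinct open clusters from the inner layer to `∂ⁱⁿΛ(R)`"; and the line's
`AvoidSection_{N,R}(ω)` = the configurations `ω'` crossing `T` (inner layer to `∂ⁱⁿΛ(R)`) inside
`T ∩ {w | ω ∉ {u ↔ w in T}}` for SOME inner-layer `u` whose `ω`-`T`-cluster reaches `∂ⁱⁿΛ(R)`;
`t_p(N,R) = ∫ P_p(AvoidSection_{N,R}(ω)) dP_p(ω)` (Tonelli form of `(P_p ⊗ P_p)(AvoidablePair)`).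

* `shellNonCertainty_of_explorationBound_of_ticm` — the ENGINE `TICM_M ⇒ NP_M`: the exploration bound
  `P(Sh(N,R)) ≤ t(N,R)` (stub A of the skeleton, hypothesis `hEB`) and `t_{p_c}(N, MN) ≤ 1 - c` eventually
  (stub B = `TICM_M`, hypothesis `hT`) give the clean shell non-certainty with `ε = min c (1/2)`.
* `nearLinearTwoClusterDecay_of_explorationBound_of_ticm` — **stubs A + B ⇒ the crux BY NAME** through the
  landed `nearLinearTwoClusterDecay_of_fixedAspectShellNonCertainty`; `critBoxTwoArmsDecay_of_explorationBound_of_ticm`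
  — the same for `PercFiniteBoxLRO.CritBoxTwoArmsDecay` (stmt-CriticalPhenomena-0859).
* `avoidIntegral_le_real_shellCrossing` — `t_p(N,R) ≤ P_p(the shell is crossed)` (the `ω`-integrand vanishes
  unless `ω` has a crossing source), whence `ticm_of_critAnnulusNonCrossing`: the certified (free but moot)
  edge `PercAnnulusCrossing.CritAnnulusNonCrossing` (stmt-CriticalPhenomena-0846) ⇒ stub B with `M = 3`.

References: the crux protocol files of stmt-5785 (line card and skeleton); G. Grimmett, *Percolation* (1999)
§7.2 (cluster exploration); B. Bollobás–O. Riordan, *Percolation* (2006) Ch. 7 p. 175 (stopping sets).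
-/

noncomputable section

open MeasureTheory Filter
open scoped Topology ENNReal
open Literature.Probability.Percolation Literature.Probability.LatticeModels

namespace Summit.CriticalPhenomena.PercolationContinuityZ3.Theorems

namespace NearLinearTwoClusterDecayTICM

/-- `ENNReal` bookkeeping: a probability bounded by `ofReal (1 - c)` with `c > 0` is, as a real number, at
most `1 - min c (1/2)` (and `min c (1/2) > 0`). -/
theorem toReal_le_one_sub_min {x : ℝ≥0∞} {c : ℝ} (hx : x ≤ ENNReal.ofReal (1 - c)) :
    x.toReal ≤ 1 - min c (1 / 2) := by
  have h2 : x.toReal ≤ max (1 - c) 0 := by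
    rw [← ENNReal.toReal_ofReal']
    exact ENNReal.toReal_mono ENNReal.ofReal_ne_top hx
  refine h2.trans ?_
  rcases le_total c (1 / 2) with h | h
  · rw [min_eq_left h]
    exact max_le le_rfl (by linarith)
  · rw [min_eq_right h]
    exact max_le (by linarith) (by norm_num)

end NearLinearTwoClusterDecayTICM

open NearLinearTwoClusterDecayTICM

/-- **The engine `TICM_M ⇒ NP_M`.** If `P_{p_c}(Sh(N,R)) ≤ t_{p_c}(N,R)` for all `N, R` (the exploration bound,
stub A of the line) and, for some `M ≥ 2`, `c > 0`, eventually `t_{p_c}(N, MN) ≤ 1 - c` (stub B = `TICM_M`), then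
the clean bounded-aspect shell non-certainty holds with `ε = min c (1/2)`. -/
theorem shellNonCertainty_of_explorationBound_of_ticm
    (hEB : ∀ N R : ℕ,
      bondPercolation (zdGraph 3) (criticalProbI 3)
          {ω : BondConfig (Site 3) |
            ∃ u ∈ (↑(box 3 (N + 1)) : Set (Site 3)) \ ↑(box 3 N),
            ∃ u' ∈ (↑(box 3 (N + 1)) : Set (Site 3)) \ ↑(box 3 N),
            ∃ v ∈ innerBoundary (zdGraph 3) (box 3 R),
            ∃ v' ∈ innerBoundary (zdGraph 3) (box 3 R),
              ω ∈ openConnIn ((↑(box 3 R) : Set (Site 3)) \ ↑(box 3 N)) u v ∧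
              ω ∈ openConnIn ((↑(box 3 R) : Set (Site 3)) \ ↑(box 3 N)) u' v' ∧
              ω ∉ openConnIn ((↑(box 3 R) : Set (Site 3)) \ ↑(box 3 N)) u u'} ≤
        ∫⁻ ω, bondPercolation (zdGraph 3) (criticalProbI 3)
          {ω' : BondConfig (Site 3) |
            ∃ u ∈ (↑(box 3 (N + 1)) : Set (Site 3)) \ ↑(box 3 N),
            ∃ v ∈ innerBoundary (zdGraph 3) (box 3 R),
              ω ∈ openConnIn ((↑(box 3 R) : Set (Site 3)) \ ↑(box 3 N)) u v ∧
              ∃ u' ∈ (↑(box 3 (N + 1)) : Set (Site 3)) \ ↑(box 3 N),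
              ∃ v' ∈ innerBoundary (zdGraph 3) (box 3 R),
                ω' ∈ openConnIn ((((↑(box 3 R) : Set (Site 3)) \ ↑(box 3 N))) ∩
                  {w : Site 3 | ω ∉ openConnIn ((↑(box 3 R) : Set (Site 3)) \ ↑(box 3 N)) u w}) u' v'}
          ∂(bondPercolation (zdGraph 3) (criticalProbI 3)))
    (hT : ∃ M : ℕ, 2 ≤ M ∧ ∃ c : ℝ, 0 < c ∧ ∀ᶠ N : ℕ in atTop,
      ∫⁻ ω, bondPercolation (zdGraph 3) (criticalProbI 3)
          {ω' : BondConfig (Site 3) |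
            ∃ u ∈ (↑(box 3 (N + 1)) : Set (Site 3)) \ ↑(box 3 N),
            ∃ v ∈ innerBoundary (zdGraph 3) (box 3 (M * N)),
              ω ∈ openConnIn ((↑(box 3 (M * N)) : Set (Site 3)) \ ↑(box 3 N)) u v ∧
              ∃ u' ∈ (↑(box 3 (N + 1)) : Set (Site 3)) \ ↑(box 3 N),
              ∃ v' ∈ innerBoundary (zdGraph 3) (box 3 (M * N)),
                ω' ∈ openConnIn ((((↑(box 3 (M * N)) : Set (Site 3)) \ ↑(box 3 N))) ∩
                  {w : Site 3 | ω ∉ openConnIn ((↑(box 3 (M * N)) : Set (Site 3)) \ ↑(box 3 N)) u w})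
                  u' v'}
        ∂(bondPercolation (zdGraph 3) (criticalProbI 3)) ≤ ENNReal.ofReal (1 - c)) :
    ∃ M : ℕ, 2 ≤ M ∧ ∃ ε : ℝ, 0 < ε ∧ ∀ᶠ N : ℕ in atTop,
      (bondPercolation (zdGraph 3) (criticalProbI 3)).real
          {ω | ∃ u ∈ (↑(box 3 (N + 1)) : Set (Site 3)) \ ↑(box 3 N),
            ∃ u' ∈ (↑(box 3 (N + 1)) : Set (Site 3)) \ ↑(box 3 N),
            ∃ v ∈ innerBoundary (zdGraph 3) (box 3 (M * N)),
            ∃ v' ∈ innerBoundary (zdGraph 3) (box 3 (M * N)),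
              ω ∈ openConnIn ((↑(box 3 (M * N)) : Set (Site 3)) \ ↑(box 3 N)) u v ∧
              ω ∈ openConnIn ((↑(box 3 (M * N)) : Set (Site 3)) \ ↑(box 3 N)) u' v' ∧
              ω ∉ openConnIn ((↑(box 3 (M * N)) : Set (Site 3)) \ ↑(box 3 N)) u u'}
        ≤ 1 - ε := by
  obtain ⟨M, hM, c, hc, hev⟩ := hT
  refine ⟨M, hM, min c (1 / 2), lt_min hc (by norm_num), ?_⟩
  filter_upwards [hev] with N hN
  rw [measureReal_def]
  exact toReal_le_one_sub_min ((hEB N (M * N)).trans hN)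

/-- **Stubs A + B ⇒ the crux `NearLinearTwoClusterDecay` BY NAME** (the line
`first-cluster-exploration-independent-crossings-meet` closed modulo its two registered stubs, composed
through the landed orange-peeling chain `nearLinearTwoClusterDecay_of_fixedAspectShellNonCertainty`). -/
theorem nearLinearTwoClusterDecay_of_explorationBound_of_ticm
    (hEB : ∀ N R : ℕ,
      bondPercolation (zdGraph 3) (criticalProbI 3)
          {ω : BondConfig (Site 3) |
            ∃ u ∈ (↑(box 3 (N + 1)) : Set (Site 3)) \ ↑(box 3 N),
            ∃ u' ∈ (↑(box 3 (N + 1)) : Set (Site 3)) \ ↑(box 3 N),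
            ∃ v ∈ innerBoundary (zdGraph 3) (box 3 R),
            ∃ v' ∈ innerBoundary (zdGraph 3) (box 3 R),
              ω ∈ openConnIn ((↑(box 3 R) : Set (Site 3)) \ ↑(box 3 N)) u v ∧
              ω ∈ openConnIn ((↑(box 3 R) : Set (Site 3)) \ ↑(box 3 N)) u' v' ∧
              ω ∉ openConnIn ((↑(box 3 R) : Set (Site 3)) \ ↑(box 3 N)) u u'} ≤
        ∫⁻ ω, bondPercolation (zdGraph 3) (criticalProbI 3)
          {ω' : BondConfig (Site 3) |
            ∃ u ∈ (↑(box 3 (N + 1)) : Set (Site 3)) \ ↑(box 3 N),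
            ∃ v ∈ innerBoundary (zdGraph 3) (box 3 R),
              ω ∈ openConnIn ((↑(box 3 R) : Set (Site 3)) \ ↑(box 3 N)) u v ∧
              ∃ u' ∈ (↑(box 3 (N + 1)) : Set (Site 3)) \ ↑(box 3 N),
              ∃ v' ∈ innerBoundary (zdGraph 3) (box 3 R),
                ω' ∈ openConnIn ((((↑(box 3 R) : Set (Site 3)) \ ↑(box 3 N))) ∩
                  {w : Site 3 | ω ∉ openConnIn ((↑(box 3 R) : Set (Site 3)) \ ↑(box 3 N)) u w}) u' v'}
          ∂(bondPercolation (zdGraph 3) (criticalProbI 3)))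
    (hT : ∃ M : ℕ, 2 ≤ M ∧ ∃ c : ℝ, 0 < c ∧ ∀ᶠ N : ℕ in atTop,
      ∫⁻ ω, bondPercolation (zdGraph 3) (criticalProbI 3)
          {ω' : BondConfig (Site 3) |
            ∃ u ∈ (↑(box 3 (N + 1)) : Set (Site 3)) \ ↑(box 3 N),
            ∃ v ∈ innerBoundary (zdGraph 3) (box 3 (M * N)),
              ω ∈ openConnIn ((↑(box 3 (M * N)) : Set (Site 3)) \ ↑(box 3 N)) u v ∧
              ∃ u' ∈ (↑(box 3 (N + 1)) : Set (Site 3)) \ ↑(box 3 N),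
              ∃ v' ∈ innerBoundary (zdGraph 3) (box 3 (M * N)),
                ω' ∈ openConnIn ((((↑(box 3 (M * N)) : Set (Site 3)) \ ↑(box 3 N))) ∩
                  {w : Site 3 | ω ∉ openConnIn ((↑(box 3 (M * N)) : Set (Site 3)) \ ↑(box 3 N)) u w})
                  u' v'}
        ∂(bondPercolation (zdGraph 3) (criticalProbI 3)) ≤ ENNReal.ofReal (1 - c)) :
    Summit.CriticalPhenomena.PercolationContinuityZ3.Theses.PercShatteringRace.NearLinearTwoClusterDecay :=
  nearLinearTwoClusterDecay_of_fixedAspectShellNonCertainty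
    (shellNonCertainty_of_explorationBound_of_ticm hEB hT)

/-- **Stubs A + B ⇒ `PercFiniteBoxLRO.CritBoxTwoArmsDecay`** (stmt-CriticalPhenomena-0859, `U(b)` for
every `b > 0`). -/
theorem critBoxTwoArmsDecay_of_explorationBound_of_ticm
    (hEB : ∀ N R : ℕ,
      bondPercolation (zdGraph 3) (criticalProbI 3)
          {ω : BondConfig (Site 3) |
            ∃ u ∈ (↑(box 3 (N + 1)) : Set (Site 3)) \ ↑(box 3 N),
            ∃ u' ∈ (↑(box 3 (N + 1)) : Set (Site 3)) \ ↑(box 3 N),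
            ∃ v ∈ innerBoundary (zdGraph 3) (box 3 R),
            ∃ v' ∈ innerBoundary (zdGraph 3) (box 3 R),
              ω ∈ openConnIn ((↑(box 3 R) : Set (Site 3)) \ ↑(box 3 N)) u v ∧
              ω ∈ openConnIn ((↑(box 3 R) : Set (Site 3)) \ ↑(box 3 N)) u' v' ∧
              ω ∉ openConnIn ((↑(box 3 R) : Set (Site 3)) \ ↑(box 3 N)) u u'} ≤
        ∫⁻ ω, bondPercolation (zdGraph 3) (criticalProbI 3)
          {ω' : BondConfig (Site 3) |
            ∃ u ∈ (↑(box 3 (N + 1)) : Set (Site 3)) \ ↑(box 3 N),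
            ∃ v ∈ innerBoundary (zdGraph 3) (box 3 R),
              ω ∈ openConnIn ((↑(box 3 R) : Set (Site 3)) \ ↑(box 3 N)) u v ∧
              ∃ u' ∈ (↑(box 3 (N + 1)) : Set (Site 3)) \ ↑(box 3 N),
              ∃ v' ∈ innerBoundary (zdGraph 3) (box 3 R),
                ω' ∈ openConnIn ((((↑(box 3 R) : Set (Site 3)) \ ↑(box 3 N))) ∩
                  {w : Site 3 | ω ∉ openConnIn ((↑(box 3 R) : Set (Site 3)) \ ↑(box 3 N)) u w}) u' v'}
          ∂(bondPercolation (zdGraph 3) (criticalProbI 3)))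
    (hT : ∃ M : ℕ, 2 ≤ M ∧ ∃ c : ℝ, 0 < c ∧ ∀ᶠ N : ℕ in atTop,
      ∫⁻ ω, bondPercolation (zdGraph 3) (criticalProbI 3)
          {ω' : BondConfig (Site 3) |
            ∃ u ∈ (↑(box 3 (N + 1)) : Set (Site 3)) \ ↑(box 3 N),
            ∃ v ∈ innerBoundary (zdGraph 3) (box 3 (M * N)),
              ω ∈ openConnIn ((↑(box 3 (M * N)) : Set (Site 3)) \ ↑(box 3 N)) u v ∧
              ∃ u' ∈ (↑(box 3 (N + 1)) : Set (Site 3)) \ ↑(box 3 N),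
              ∃ v' ∈ innerBoundary (zdGraph 3) (box 3 (M * N)),
                ω' ∈ openConnIn ((((↑(box 3 (M * N)) : Set (Site 3)) \ ↑(box 3 N))) ∩
                  {w : Site 3 | ω ∉ openConnIn ((↑(box 3 (M * N)) : Set (Site 3)) \ ↑(box 3 N)) u w})
                  u' v'}
        ∂(bondPercolation (zdGraph 3) (criticalProbI 3)) ≤ ENNReal.ofReal (1 - c)) :
    Summit.CriticalPhenomena.PercolationContinuityZ3.Theses.PercFiniteBoxLRO.CritBoxTwoArmsDecay :=
  critBoxTwoArmsDecay_of_fixedAspectShellNonCertainty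
    (shellNonCertainty_of_explorationBound_of_ticm hEB hT)

/-! ## The admissible weakening: polylog-sparse `TICM` suffices (landed sparse peel chain) -/

namespace NearLinearTwoClusterDecayTICM

/-- `ENNReal` bookkeeping for the sparse form: for `N ≥ 3` (so that `log N ≥ 1`), a probability bounded by
`ofReal (1 - c/(log N)^σ)` (`σ ≥ 0`) is, as a real number, at most `1 - min c (1/2)/(log N)^σ`. -/
theorem toReal_le_one_sub_min_div {x : ℝ≥0∞} {c σ : ℝ} (hσ : 0 ≤ σ) {N : ℕ} (hN : 3 ≤ N)
    (hx : x ≤ ENNReal.ofReal (1 - c / Real.log N ^ σ)) :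
    x.toReal ≤ 1 - min c (1 / 2) / Real.log N ^ σ := by
  have hlog : 1 ≤ Real.log N := by
    have h3 : (3 : ℝ) ≤ N := by exact_mod_cast hN
    have he : Real.exp 1 ≤ (N : ℝ) := le_trans (by linarith [Real.exp_one_lt_d9.le]) h3
    simpa using Real.log_le_log (Real.exp_pos 1) he
  have hpow : 1 ≤ Real.log N ^ σ := Real.one_le_rpow hlog hσ
  have hpos : 0 < Real.log N ^ σ := lt_of_lt_of_le one_pos hpow
  have h2 : x.toReal ≤ max (1 - c / Real.log N ^ σ) 0 := by
    rw [← ENNReal.toReal_ofReal']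
    exact ENNReal.toReal_mono ENNReal.ofReal_ne_top hx
  refine h2.trans (max_le ?_ ?_)
  · have : min c (1 / 2) / Real.log N ^ σ ≤ c / Real.log N ^ σ :=
      div_le_div_of_nonneg_right (min_le_left _ _) hpos.le
    linarith
  · have : min c (1 / 2) / Real.log N ^ σ ≤ 1 / 2 := by
      rw [div_le_iff₀ hpos]
      calc min c (1 / 2) ≤ 1 / 2 := min_le_right _ _
        _ = 1 / 2 * 1 := (mul_one _).symm
        _ ≤ 1 / 2 * Real.log N ^ σ := mul_le_mul_of_nonneg_left hpow (by norm_num)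
    linarith

end NearLinearTwoClusterDecayTICM

/-- **Polylog-sparse `TICM` suffices** (admissible weakening of stub B, same composition through the landed
sparse peel chain `nearLinearTwoClusterDecay_of_sparseShellNonCertainty`): with the exploration bound (stub A),
ONE good skin `t_{p_c}(M^ℓ N, M^{ℓ+1} N) ≤ 1 - c/(log N)^σ` (`σ < 1`) in every window of `L` consecutive skins of
the geometric chain above `N`, for all large `N`, gives the crux by name. -/
theorem nearLinearTwoClusterDecay_of_explorationBound_of_sparseTicm
    (hEB : ∀ N R : ℕ,
      bondPercolation (zdGraph 3) (criticalProbI 3)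
          {ω : BondConfig (Site 3) |
            ∃ u ∈ (↑(box 3 (N + 1)) : Set (Site 3)) \ ↑(box 3 N),
            ∃ u' ∈ (↑(box 3 (N + 1)) : Set (Site 3)) \ ↑(box 3 N),
            ∃ v ∈ innerBoundary (zdGraph 3) (box 3 R),
            ∃ v' ∈ innerBoundary (zdGraph 3) (box 3 R),
              ω ∈ openConnIn ((↑(box 3 R) : Set (Site 3)) \ ↑(box 3 N)) u v ∧
              ω ∈ openConnIn ((↑(box 3 R) : Set (Site 3)) \ ↑(box 3 N)) u' v' ∧
              ω ∉ openConnIn ((↑(box 3 R) : Set (Site 3)) \ ↑(box 3 N)) u u'} ≤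
        ∫⁻ ω, bondPercolation (zdGraph 3) (criticalProbI 3)
          {ω' : BondConfig (Site 3) |
            ∃ u ∈ (↑(box 3 (N + 1)) : Set (Site 3)) \ ↑(box 3 N),
            ∃ v ∈ innerBoundary (zdGraph 3) (box 3 R),
              ω ∈ openConnIn ((↑(box 3 R) : Set (Site 3)) \ ↑(box 3 N)) u v ∧
              ∃ u' ∈ (↑(box 3 (N + 1)) : Set (Site 3)) \ ↑(box 3 N),
              ∃ v' ∈ innerBoundary (zdGraph 3) (box 3 R),
                ω' ∈ openConnIn ((((↑(box 3 R) : Set (Site 3)) \ ↑(box 3 N))) ∩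
                  {w : Site 3 | ω ∉ openConnIn ((↑(box 3 R) : Set (Site 3)) \ ↑(box 3 N)) u w}) u' v'}
          ∂(bondPercolation (zdGraph 3) (criticalProbI 3)))
    (hT : ∃ M : ℕ, 2 ≤ M ∧ ∃ σ : ℝ, 0 ≤ σ ∧ σ < 1 ∧ ∃ c : ℝ, 0 < c ∧ ∃ L : ℕ,
      ∀ᶠ N : ℕ in atTop, ∃ ℓ < L,
      ∫⁻ ω, bondPercolation (zdGraph 3) (criticalProbI 3)
          {ω' : BondConfig (Site 3) |
            ∃ u ∈ (↑(box 3 (M ^ ℓ * N + 1)) : Set (Site 3)) \ ↑(box 3 (M ^ ℓ * N)),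
            ∃ v ∈ innerBoundary (zdGraph 3) (box 3 (M ^ (ℓ + 1) * N)),
              ω ∈ openConnIn ((↑(box 3 (M ^ (ℓ + 1) * N)) : Set (Site 3)) \ ↑(box 3 (M ^ ℓ * N))) u v ∧
              ∃ u' ∈ (↑(box 3 (M ^ ℓ * N + 1)) : Set (Site 3)) \ ↑(box 3 (M ^ ℓ * N)),
              ∃ v' ∈ innerBoundary (zdGraph 3) (box 3 (M ^ (ℓ + 1) * N)),
                ω' ∈ openConnIn ((((↑(box 3 (M ^ (ℓ + 1) * N)) : Set (Site 3)) \ ↑(box 3 (M ^ ℓ * N)))) ∩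
                  {w : Site 3 | ω ∉ openConnIn ((↑(box 3 (M ^ (ℓ + 1) * N)) : Set (Site 3)) \
                    ↑(box 3 (M ^ ℓ * N))) u w}) u' v'}
        ∂(bondPercolation (zdGraph 3) (criticalProbI 3)) ≤ ENNReal.ofReal (1 - c / Real.log N ^ σ)) :
    Summit.CriticalPhenomena.PercolationContinuityZ3.Theses.PercShatteringRace.NearLinearTwoClusterDecay := by
  obtain ⟨M, hM, σ, hσ0, hσ1, c, hc, L, hev⟩ := hT
  refine nearLinearTwoClusterDecay_of_sparseShellNonCertainty
    ⟨M, hM, σ, hσ0, hσ1, min c (1 / 2), lt_min hc (by norm_num), L, ?_⟩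
  filter_upwards [hev, eventually_ge_atTop 3] with N hN hN3
  obtain ⟨ℓ, hℓ, hgood⟩ := hN
  refine ⟨ℓ, hℓ, ?_⟩
  rw [measureReal_def]
  exact toReal_le_one_sub_min_div hσ0 hN3 ((hEB (M ^ ℓ * N) (M ^ (ℓ + 1) * N)).trans hgood)

/-! ## The free-but-moot edge: `CritAnnulusNonCrossing` (stmt-0846) ⇒ stub B (`TICM_3`) -/

/-- **`t_p(N,R) ≤ P_p(a shell crossing exists)`**: the `ω`-integrand of the avoidable-pair integral is at
most the indicator that `ω` has an inner-layer point joined inside `T(N,R)` to `∂ⁱⁿΛ(R)` (and a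
probability is at most `1`). -/
theorem avoidIntegral_le_shellCrossing (p : unitInterval) (N R : ℕ) :
    ∫⁻ ω, bondPercolation (zdGraph 3) p
        {ω' : BondConfig (Site 3) |
          ∃ u ∈ (↑(box 3 (N + 1)) : Set (Site 3)) \ ↑(box 3 N),
          ∃ v ∈ innerBoundary (zdGraph 3) (box 3 R),
            ω ∈ openConnIn ((↑(box 3 R) : Set (Site 3)) \ ↑(box 3 N)) u v ∧
            ∃ u' ∈ (↑(box 3 (N + 1)) : Set (Site 3)) \ ↑(box 3 N),
            ∃ v' ∈ innerBoundary (zdGraph 3) (box 3 R),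
              ω' ∈ openConnIn ((((↑(box 3 R) : Set (Site 3)) \ ↑(box 3 N))) ∩
                {w : Site 3 | ω ∉ openConnIn ((↑(box 3 R) : Set (Site 3)) \ ↑(box 3 N)) u w}) u' v'}
        ∂(bondPercolation (zdGraph 3) p) ≤
      bondPercolation (zdGraph 3) p
        {ω : BondConfig (Site 3) | ∃ u ∈ (↑(box 3 (N + 1)) : Set (Site 3)) \ ↑(box 3 N),
          ∃ v ∈ innerBoundary (zdGraph 3) (box 3 R),
            ω ∈ openConnIn ((↑(box 3 R) : Set (Site 3)) \ ↑(box 3 N)) u v} := by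
  set E : Set (BondConfig (Site 3)) := {ω | ∃ u ∈ (↑(box 3 (N + 1)) : Set (Site 3)) \ ↑(box 3 N),
    ∃ v ∈ innerBoundary (zdGraph 3) (box 3 R),
      ω ∈ openConnIn ((↑(box 3 R) : Set (Site 3)) \ ↑(box 3 N)) u v} with hE
  have hmeas : MeasurableSet E := by
    have : E = ⋃ u ∈ ((↑(box 3 (N + 1)) : Set (Site 3)) \ ↑(box 3 N)),
        ⋃ v ∈ (↑(innerBoundary (zdGraph 3) (box 3 R)) : Set (Site 3)),
          openConnIn ((↑(box 3 R) : Set (Site 3)) \ ↑(box 3 N)) u v := by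
      ext ω
      simp only [hE, Set.mem_setOf_eq, Set.mem_iUnion, Finset.mem_coe, exists_prop]
    rw [this]
    refine MeasurableSet.biUnion (Set.to_countable _) fun u _ => ?_
    refine MeasurableSet.biUnion (Set.to_countable _) fun v _ => ?_
    rw [← Finset.coe_sdiff]
    exact DCT16.measurableSet_openConnIn _ u v
  calc ∫⁻ ω, bondPercolation (zdGraph 3) p
        {ω' : BondConfig (Site 3) |
          ∃ u ∈ (↑(box 3 (N + 1)) : Set (Site 3)) \ ↑(box 3 N),
          ∃ v ∈ innerBoundary (zdGraph 3) (box 3 R),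
            ω ∈ openConnIn ((↑(box 3 R) : Set (Site 3)) \ ↑(box 3 N)) u v ∧
            ∃ u' ∈ (↑(box 3 (N + 1)) : Set (Site 3)) \ ↑(box 3 N),
            ∃ v' ∈ innerBoundary (zdGraph 3) (box 3 R),
              ω' ∈ openConnIn ((((↑(box 3 R) : Set (Site 3)) \ ↑(box 3 N))) ∩
                {w : Site 3 | ω ∉ openConnIn ((↑(box 3 R) : Set (Site 3)) \ ↑(box 3 N)) u w}) u' v'}
        ∂(bondPercolation (zdGraph 3) p)
      ≤ ∫⁻ ω, E.indicator (fun _ => (1 : ℝ≥0∞)) ω ∂(bondPercolation (zdGraph 3) p) := by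
        refine lintegral_mono fun ω => ?_
        by_cases hω : ω ∈ E
        · rw [Set.indicator_of_mem hω]
          exact prob_le_one
        · rw [Set.indicator_of_notMem hω]
          have : {ω' : BondConfig (Site 3) |
              ∃ u ∈ (↑(box 3 (N + 1)) : Set (Site 3)) \ ↑(box 3 N),
              ∃ v ∈ innerBoundary (zdGraph 3) (box 3 R),
                ω ∈ openConnIn ((↑(box 3 R) : Set (Site 3)) \ ↑(box 3 N)) u v ∧
                ∃ u' ∈ (↑(box 3 (N + 1)) : Set (Site 3)) \ ↑(box 3 N),
                ∃ v' ∈ innerBoundary (zdGraph 3) (box 3 R),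
                  ω' ∈ openConnIn ((((↑(box 3 R) : Set (Site 3)) \ ↑(box 3 N))) ∩
                    {w : Site 3 | ω ∉ openConnIn ((↑(box 3 R) : Set (Site 3)) \ ↑(box 3 N)) u w})
                    u' v'} = ∅ := by
            ext ω'
            simp only [Set.mem_setOf_eq, Set.mem_empty_iff_false, iff_false]
            rintro ⟨u, hu, v, hv, huv, -⟩
            exact hω ⟨u, hu, v, hv, huv⟩
          rw [this, measure_empty]
    _ = bondPercolation (zdGraph 3) p E := lintegral_indicator_one hmeas

/-- **`CritAnnulusNonCrossing` (stmt-CriticalPhenomena-0846) ⇒ stub B (`TICM_M` with `M = 3` and the same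
constant)** — the free-but-moot edge recorded on the line card: for `N ≥ 3` a shell crossing of
`Λ(3N) ∖ Λ(N)` contains an annulus crossing `Λ(N+1) → ∂ⁱⁿΛ(2(N+1))` inside `Λ(2(N+1))`
(`exists_annulusCrossing_of_shellCrossing`, landed), and `t ≤ P(shell crossing)`. -/
theorem ticm_of_critAnnulusNonCrossing
    (h : Summit.CriticalPhenomena.PercolationContinuityZ3.Theses.PercAnnulusCrossing.CritAnnulusNonCrossing) :
    ∃ M : ℕ, 2 ≤ M ∧ ∃ c : ℝ, 0 < c ∧ ∀ᶠ N : ℕ in atTop,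
      ∫⁻ ω, bondPercolation (zdGraph 3) (criticalProbI 3)
          {ω' : BondConfig (Site 3) |
            ∃ u ∈ (↑(box 3 (N + 1)) : Set (Site 3)) \ ↑(box 3 N),
            ∃ v ∈ innerBoundary (zdGraph 3) (box 3 (M * N)),
              ω ∈ openConnIn ((↑(box 3 (M * N)) : Set (Site 3)) \ ↑(box 3 N)) u v ∧
              ∃ u' ∈ (↑(box 3 (N + 1)) : Set (Site 3)) \ ↑(box 3 N),
              ∃ v' ∈ innerBoundary (zdGraph 3) (box 3 (M * N)),
                ω' ∈ openConnIn ((((↑(box 3 (M * N)) : Set (Site 3)) \ ↑(box 3 N))) ∩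
                  {w : Site 3 | ω ∉ openConnIn ((↑(box 3 (M * N)) : Set (Site 3)) \ ↑(box 3 N)) u w})
                  u' v'}
        ∂(bondPercolation (zdGraph 3) (criticalProbI 3)) ≤ ENNReal.ofReal (1 - c) := by
  obtain ⟨c, hc, hB⟩ := h
  refine ⟨3, by norm_num, c, hc, ?_⟩
  filter_upwards [eventually_ge_atTop 3] with N hN
  have hMN : 2 * (N + 1) < 3 * N := by omega
  refine (avoidIntegral_le_shellCrossing (criticalProbI 3) N (3 * N)).trans ?_
  have key : (bondPercolation (zdGraph 3) (criticalProbI 3)).real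
        {ω : BondConfig (Site 3) | ∃ u ∈ (↑(box 3 (N + 1)) : Set (Site 3)) \ ↑(box 3 N),
          ∃ v ∈ innerBoundary (zdGraph 3) (box 3 (3 * N)),
            ω ∈ openConnIn ((↑(box 3 (3 * N)) : Set (Site 3)) \ ↑(box 3 N)) u v} ≤ 1 - c :=
    calc (bondPercolation (zdGraph 3) (criticalProbI 3)).real
          {ω : BondConfig (Site 3) | ∃ u ∈ (↑(box 3 (N + 1)) : Set (Site 3)) \ ↑(box 3 N),
            ∃ v ∈ innerBoundary (zdGraph 3) (box 3 (3 * N)),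
              ω ∈ openConnIn ((↑(box 3 (3 * N)) : Set (Site 3)) \ ↑(box 3 N)) u v}
        ≤ (bondPercolation (zdGraph 3) (criticalProbI 3)).real
            {ω | ∃ x ∈ box 3 (N + 1), ∃ y ∈ innerBoundary (zdGraph 3) (box 3 (2 * (N + 1))),
              ω ∈ openConnIn (↑(box 3 (2 * (N + 1))) : Set (Site 3)) x y} :=
          DCT16.real_mono_of_forall_subset_edgeSet (zdGraph 3) (criticalProbI 3)
            fun ω hω ⟨u, hu, v, hv, huv⟩ => exists_annulusCrossing_of_shellCrossing hMN hω hu hv huv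
      _ ≤ 1 - c := hB (N + 1) (by omega)
  rw [measureReal_def] at key
  rw [← ENNReal.ofReal_toReal (measure_ne_top _ _)]
  exact ENNReal.ofReal_le_ofReal key

end Summit.CriticalPhenomena.PercolationContinuityZ3.Theorems

end
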